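import Summits.CriticalPhenomena.PercolationContinuityZ3.Theorems.PercNearOneGluingNoHeavyLowerTailFrontierDecRowsKeyCellDict
import HarnessLib

/-!
# Monotonicity of five-point pattern events BY DECISION: a finite check on the 52 consistent patterns

Support file (prover seat `prim-facecert`, gen 5; `--supports stmt-CriticalPhenomena-4575`).  No named facts, no sorries, no `native_decide`;
bookkeeping Boolean tests `patLe`, `antitoneCheck`, `monotoneCheck` only.  Sequel of `…FrontierDecRowsKeyCellDict`.

For a kernel certificate in the 52 cells every Harris row needs `IsLowerSet (pev Φ v)` (or `IsUpperSet`) for its two events.  When `Φ` is given by its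
TRUTH TABLE on the 52 cells (as a certificate generator produces it), monotonicity is the finite condition "for consistent patterns `m ⊆ m'` (bitwise),
`Φ(mrel m') → Φ(mrel m)`" — `antitoneCheck Φ`, decidable by `decide`, and **`isLowerSet_pev_of_antitoneCheck`**: it implies `IsLowerSet (pev Φ v)` for every
marking `v` of every graph (the connectivity pattern of a sub-configuration is a consistent sub-pattern: `isUpperSet_openConn`, `consistent_of_mem_cell`,
`connMatrix_eq_mrel`).  Dually `monotoneCheck` / `isUpperSet_pev_of_monotoneCheck`.  So `harrisExpr_nonneg_of_lower/upper` apply to mask-defined events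
without any case analysis of the event's shape.
-/

noncomputable section

namespace Summit.CriticalPhenomena.PercolationContinuityZ3.Theorems

namespace TerminalEdgeInduction

open MeasureTheory Literature.Probability.Percolation Literature.Probability.LatticeModels
open EdgeInduction CovTransferCert E3GroupSepCert PatternCells FaceCertKernelN
open scoped Classical

variable {n : ℕ}

/-- Bitwise containment of two 10-bit patterns. [folklore] -/
def patLe (m m' : ℕ) : Bool := (List.range 10).all fun p => !(Nat.testBit m p) || Nat.testBit m' p

/-- `Φ` is antitone on the consistent patterns: `m ⊆ m'`, `Φ m'` ⇒ `Φ m`. [this work] -/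
def antitoneCheck (Φ : (Fin 5 → Fin 5 → Bool) → Bool) : Bool :=
  cellCodeList.all fun m => cellCodeList.all fun m' => !(patLe m m' && Φ (mrel m')) || Φ (mrel m)

/-- `Φ` is monotone on the consistent patterns: `m ⊆ m'`, `Φ m` ⇒ `Φ m'`. [this work] -/
def monotoneCheck (Φ : (Fin 5 → Fin 5 → Bool) → Bool) : Bool :=
  cellCodeList.all fun m => cellCodeList.all fun m' => !(patLe m m' && Φ (mrel m)) || Φ (mrel m')

/-- The pattern of a nonempty cell is one of the 52 codes. [this work] -/
theorem mem_cellCodeList_of_mem_cell (v : Fin 5 → Fin n) {m : ℕ} (hm : m < 1024) {ω : BondConfig (Fin n)} (hω : ω ∈ Cell v m) :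
    m ∈ cellCodeList := by
  have h : m ∈ ((Finset.range 1024).filter fun m => Cons5 m = true) :=
    Finset.mem_filter.2 ⟨Finset.mem_range.2 hm, consistent_of_mem_cell v hω⟩
  rw [cellCodes_eq, List.mem_toFinset] at h
  exact h

/-- A sub-configuration has a bitwise sub-pattern. [this work] -/
theorem patLe_of_le (v : Fin 5 → Fin n) {m m' : ℕ} {ω ω' : BondConfig (Fin n)} (hle : ω' ≤ ω) (hω' : ω' ∈ Cell v m) (hω : ω ∈ Cell v m') :
    patLe m m' = true := by
  simp only [patLe, List.all_eq_true, List.mem_range, Bool.or_eq_true, Bool.not_eq_true']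
  intro p hp
  by_cases hb : Nat.testBit m p = true
  · right
    have hr : (openGraph ω').Reachable (v (pairFst ⟨p, hp⟩)) (v (pairSnd ⟨p, hp⟩)) := (hω' ⟨p, hp⟩).2 hb
    have hr' : (openGraph ω).Reachable (v (pairFst ⟨p, hp⟩)) (v (pairSnd ⟨p, hp⟩)) :=
      isUpperSet_openConn (v (pairFst ⟨p, hp⟩)) (v (pairSnd ⟨p, hp⟩)) hle hr
    exact (hω ⟨p, hp⟩).1 hr'
  · left; simpa using hb

/-- **Decreasing by decision.** [this work] -/
theorem isLowerSet_pev_of_antitoneCheck (Φ : (Fin 5 → Fin 5 → Bool) → Bool) (h : antitoneCheck Φ = true) (v : Fin 5 → Fin n) :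
    IsLowerSet (pev Φ v) := by
  intro ω ω' hle hω
  obtain ⟨m, hm, hcell⟩ := exists_mem_cell v ω'
  obtain ⟨m', hm', hcell'⟩ := exists_mem_cell v ω
  have hΦ' : Φ (mrel m') = true := (mem_pev_iff_of_mem_cell Φ v hcell').1 hω
  have hle' : patLe m m' = true := patLe_of_le v hle hcell hcell'
  simp only [antitoneCheck, List.all_eq_true, Bool.or_eq_true, Bool.not_eq_true', Bool.and_eq_false_imp] at h
  have hΦ : Φ (mrel m) = true := by
    rcases h m (mem_cellCodeList_of_mem_cell v hm hcell) m' (mem_cellCodeList_of_mem_cell v hm' hcell') with h1 | h1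
    · exact absurd hΦ' (by simp [h1 hle'])
    · exact h1
  exact (mem_pev_iff_of_mem_cell Φ v hcell).2 hΦ

/-- **Increasing by decision.** [this work] -/
theorem isUpperSet_pev_of_monotoneCheck (Φ : (Fin 5 → Fin 5 → Bool) → Bool) (h : monotoneCheck Φ = true) (v : Fin 5 → Fin n) :
    IsUpperSet (pev Φ v) := by
  intro ω' ω hle hω'
  obtain ⟨m, hm, hcell⟩ := exists_mem_cell v ω'
  obtain ⟨m', hm', hcell'⟩ := exists_mem_cell v ω
  have hΦ : Φ (mrel m) = true := (mem_pev_iff_of_mem_cell Φ v hcell).1 hω'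
  have hle' : patLe m m' = true := patLe_of_le v hle hcell hcell'
  simp only [monotoneCheck, List.all_eq_true, Bool.or_eq_true, Bool.not_eq_true', Bool.and_eq_false_imp] at h
  have hΦ' : Φ (mrel m') = true := by
    rcases h m (mem_cellCodeList_of_mem_cell v hm hcell) m' (mem_cellCodeList_of_mem_cell v hm' hcell') with h1 | h1
    · exact absurd hΦ (by simp [h1 hle'])
    · exact h1
  exact (mem_pev_iff_of_mem_cell Φ v hcell').2 hΦ'

/-- Example / test: `D[a|b]` read on five points passes the antitone check. [this work] -/
example : antitoneCheck (sepPat [0] [1]) = true := by decide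

end TerminalEdgeInduction

end Summit.CriticalPhenomena.PercolationContinuityZ3.Theorems
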